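import Literature.Computability.Complexity.PolynomialEntropyApproximation
import Literature.Computability.MetaComplexity.SamplableMixtures
import Summits.PneNP.PneNP.Theorems.SzkEntropyPeaWorstToAvgOrbit
import HarnessLib
import Summits.PneNP.PneNP.Theorems.SzkEntropyPeaWorstToAvg
import Literature.Computability.MetaComplexity.PromiseRandReductions
import Literature.Computability.Complexity.CodeFPLists
import Literature.Computability.Complexity.PolynomialEntropyApproximationDegOne

-- ===== BEGIN INLINED DEFS (work/Defs.lean) =====

/-!
# Route SzkEntropy, crux `PeaWorstToAvg` (stmt-PneNP-10777): objects of the line `orbit-pair-rsr` (definitions + glue)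

Objects posited by the line `orbit-pair-rsr` for the crux `SzkEntropy.PeaWorstToAvg` (skeleton
`Summits/PneNP/PneNP/Cruxes/PeaWorstToAvg/Lines/orbit-pair-rsr.lean`, whose registered stubs
`stub_transfer`, `stub_randClosure`, `stub_orbitKit`, `stub_adviceElim`, `stub_orbitRSR` are stated in exactly this
vocabulary and namespace), landed verbatim from §1/§3 of that skeleton so that every stub proof can state its registered
signature by the same short names:

* `affOut`, `AffEquiv` — affine relabelling of output words and affine equivalence of sparse cubic maps on the same
  `s` variables (`Q = (B·+c) ∘ P ∘ (A·+b)`, `A ∈ GL_s(F₂)`, `B ∈ GL_m(F₂)`; Patarin's IP2S relation at equal formats);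
* `OrbitSet`, `OrbitPair`, `Side`, `bySide` — the orbit instances of an explicit family `p = (pˢ)ₛ` at thresholds `k`,
  the ORBIT-PAIR promise problem of two families (YES = orbit of `p₁`, NO = orbit of `p₀`, same encoding as `PEA`),
  its size slices, and the Boolean indexing of the pair;
* `IsPUniform`, `Separated` — `P`-uniformity of an explicit instance sequence and entropy separation across `k` from
  size `1` on;
* `OrbitKit` (+ `OrbitKit.law`, `OrbitKit.mix`) — a UNIFORM planted sampler of each orbit at size `n + 1` and an in-orbit
  re-randomiser `1/16`-close to the planted law (the object asserted by `stub_orbitKit`);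
* glue (sorry-free, §3 of the skeleton): `AffEquiv.entropy_eq` (entropy is an orbit invariant), `orbitSet_yes_subset`,
  `orbitSet_no_subset`, `orbitPair_yes_le`, `orbitPair_no_le`, `orbitPair_polyTimeReducible_PEA` (`OrbitPair ≤ₚ PEA 3`
  by the identity), `orbitPair_disjoint`, `side_one_subset_yes`, `side_zero_subset_no`, `OrbitKit.isPolySamplable_law`,
  `OrbitKit.isPolySamplable_mix`, `OrbitKit.law_false_support`, `OrbitKit.law_true_support`, `OrbitKit.mix_support`,
  and the sanity lemma `affEquiv_refl` (every map lies in its own orbit: the orbit sets are inhabited by the base points).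

The uniform heuristic class `UHeurBPP` used by `stub_adviceElim` / `stub_orbitRSR` is NOT redeclared here: the line uses
`Summit.PneNP.PneNP.Cruxes.PeaWorstToAvg.DualModeCompile.UHeurBPP` (`SzkEntropyPeaWorstToAvgDualModeCompileDefs.lean`), so
that the advice-elimination stub is literally the same proposition in both lines of this crux.
Sources: Dvir–Gutfreund–Rothblum–Vadhan, ICS 2011, §3 p. 6 and pp. 2–3 (PEA, changes of variables); J. Patarin,
EUROCRYPT 1996 (isomorphism of polynomials, IP2S); Bogdanov–Trevisan, FnT–TCS 2 (2006), Def. 2.1, 2.12–2.13;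
Grochow–Qiao, SIAM J. Comput. 52 (2023) (tensor isomorphism; cubic-form equivalence).
-/

namespace Summit.PneNP.PneNP.Cruxes.PeaWorstToAvg.OrbitPairRsr

set_option linter.dupNamespace false -- `Summit.PneNP.PneNP.…`: summit = sub-problem name (D-0017 single-conjunct layout)

open Literature.Computability.Complexity Literature.Computability.MetaComplexity
open _root_.Computability
open Summit.PneNP.PneNP.Theorems

/-! ### Affine equivalence of sparse cubic maps -/

/-- Affine relabelling of output words: `l ↦ B·v(l) + c` where `v(l) ∈ F₂^m` reads the first `m`
letters of `l` (default `0`), written back as a word of length `m`. [cite: Patarin1996, §2 (IP with two secrets)] -/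
def affOut {m : ℕ} (B : Matrix (Fin m) (Fin m) (ZMod 2)) (c : Fin m → ZMod 2)
    (l : List (ZMod 2)) : List (ZMod 2) :=
  List.ofFn (B.mulVec (fun i : Fin m => l.getD i 0) + c)

/-- Affine equivalence of sparse cubic maps on the same `s` variables (semantic, as functions
`F₂ˢ → F₂^m`, `m = P.length`): `Q = (B·+c) ∘ P ∘ (A·+b)` with `A ∈ GL_s(F₂)`, `B ∈ GL_m(F₂)`.
(Patarin's IP2S relation restricted to equal formats.) [cite: Patarin1996, §2 (IP with two secrets)] -/
def AffEquiv {s : ℕ} (P Q : PolyMapF2 s) : Prop :=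
  ∃ (A : Matrix (Fin s) (Fin s) (ZMod 2)) (b : Fin s → ZMod 2)
    (B : Matrix (Fin P.length) (Fin P.length) (ZMod 2)) (c : Fin P.length → ZMod 2),
    IsUnit A ∧ IsUnit B ∧ ∀ x : Fin s → ZMod 2, Q.eval x = affOut B c (P.eval (A.mulVec x + b))

/-! ### The orbit-pair promise problem -/

/-- The orbit instances of an explicit family `p = (pˢ)ₛ` with thresholds `k`: PEA instances
`⟨s, (q, j)⟩` with `s ≥ 1`, `j = k s`, `q` of syntactic degree `≤ 3` and affinely equivalent to `pˢ`.
[cite: DvirGutfreundRothblumVadhan2010, §3 p.6 and pp. 2–3 (changes of variables)] -/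
def OrbitSet (p : (s : ℕ) → PolyMapF2 s) (k : ℕ → ℕ) : Set PEAInst :=
  {I | 1 ≤ I.1 ∧ I.2.2 = k I.1 ∧ PolyMapF2.DegLE 3 I.2.1 ∧ AffEquiv (p I.1) I.2.1}

/-- **The orbit-pair promise problem** of two explicit cubic families: YES = orbit instances of `p₁`,
NO = orbit instances of `p₀` (same encoding as `PEA`, so that `OrbitPair ≤ₚ PEA 3` by the identity
once the pair is entropy-separated, `orbitPair_polyTimeReducible_PEA`). [cite: Patarin1996, §2 (IP with two secrets)] -/
noncomputable def OrbitPair (p₀ p₁ : (s : ℕ) → PolyMapF2 s) (k : ℕ → ℕ) : PromiseProblem :=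
  PromiseProblem.ofEncoding PEAInst.encoding (OrbitSet p₁ k) (OrbitSet p₀ k)

/-- The size-`s` slice of the orbit instances of `p`, as a language. [folklore] -/
def Side (p : (s : ℕ) → PolyMapF2 s) (k : ℕ → ℕ) (s : ℕ) : Set (List Bool) :=
  PEAInst.encoding.toLanguage {I | I ∈ OrbitSet p k ∧ I.1 = s}

/-- The two families of a pair, indexed by the answer bit (`false ↦ p₀`, `true ↦ p₁`). [folklore] -/
def bySide (p₀ p₁ : (s : ℕ) → PolyMapF2 s) : Bool → (s : ℕ) → PolyMapF2 s
  | false => p₀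
  | true => p₁

/-- `P`-uniformity of an explicit instance sequence: `1ˢ ↦ ⟨s, (pˢ, k s)⟩` is in `FP`.
[cite: AroraBarak2009, §6.2 (P-uniform families)] -/
def IsPUniform (p : (s : ℕ) → PolyMapF2 s) (k : ℕ → ℕ) : Prop :=
  ∃ f ∈ FP, ∀ s : ℕ, f (unaryEncodeNat s) = PEAInst.encoding.encode ⟨s, (p s, k s)⟩

/-- Entropy separation across the threshold from size `1` on (size `0` carries only entropy `0`;
triage r1 sharpening 1): `H(p₀ˢ) ≤ k s < k s + 1 ≤ H(p₁ˢ)` for all `s ≥ 1`.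
[cite: DvirGutfreundRothblumVadhan2010, §3 p.6 (the promise of PEA)] -/
def Separated (p₀ p₁ : (s : ℕ) → PolyMapF2 s) (k : ℕ → ℕ) : Prop :=
  ∀ s : ℕ, 1 ≤ s → (p₀ s).entropy ≤ k s ∧ (k s : ℝ) + 1 ≤ (p₁ s).entropy

/-! ### Orbit kits -/

/-- **Orbit kit** of a pair: a UNIFORM (honest polynomial coin budget — no `coinLen` advice) planted
sampler `samp b` of the size-`(n+1)` orbit of `p_b`, and an in-orbit re-randomiser `rer`, whose law
on any point of that orbit is `1/16`-close (one-sided, on every event) to the planted law.  Built in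
`stub_orbitKit` from: canonical multilinear normal form of `(B·+c) ∘ q ∘ (A·+b)` in `FP`, and a
truncated-rejection sampler of `GL(F₂)` (law `(1-f)·U(GL) + f·δ_I`, `f ≤ 0.72^t`).
[cite: BogdanovTrevisan2006, Def. 2.1 (samplable ensembles)] [cite: DvirGutfreundRothblumVadhan2010, pp. 2–3] -/
structure OrbitKit (p₀ p₁ : (s : ℕ) → PolyMapF2 s) (k : ℕ → ℕ) where
  /-- planted sampler of side `b` on input `1ⁿ` (instances of size `n + 1`) -/
  samp : Bool → RandAlg ℕ (List Bool)
  /-- the samplers are probabilistic polynomial time -/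
  samp_polyTime : ∀ b, (samp b).IsPolyTime unaryEncodeNat (id : List Bool → List Bool)
  /-- its coin budget is this polynomial of the input length (uniformity) -/
  sampCoins : Polynomial ℕ
  /-- the coin budget is honest -/
  samp_coinLen : ∀ b ℓ, (samp b).coinLen ℓ = sampCoins.eval ℓ
  /-- the planted sampler of side `b` lands in the size-`(n+1)` slice of the orbit of `p_b` -/
  samp_support : ∀ b n, ∀ w ∈ ((samp b).outputPMF unaryEncodeNat n).support,
    w ∈ Side (bySide p₀ p₁ b) k (n + 1)
  /-- in-orbit re-randomiser on instance strings -/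
  rer : RandAlg (List Bool) (List Bool)
  /-- the re-randomiser is probabilistic polynomial time -/
  rer_polyTime : rer.IsPolyTime (id : List Bool → List Bool) (id : List Bool → List Bool)
  /-- its coin budget, a polynomial -/
  rerCoins : Polynomial ℕ
  /-- the coin budget is honest -/
  rer_coinLen : ∀ ℓ, rer.coinLen ℓ = rerCoins.eval ℓ
  /-- the re-randomiser stays inside the orbit slice -/
  rer_side : ∀ b s, ∀ w ∈ Side (bySide p₀ p₁ b) k s, ∀ w' ∈ (rer.outputPMF id w).support,
    w' ∈ Side (bySide p₀ p₁ b) k s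
  /-- on every orbit point the law of `rer` is `1/16`-close (one-sided, every event) to the planted law -/
  rer_close : ∀ b n, ∀ w ∈ Side (bySide p₀ p₁ b) k (n + 1), ∀ E : Set (List Bool),
    rer.pr id w E ≤ (samp b).pr unaryEncodeNat n E + 1 / 16

namespace OrbitKit

variable {p₀ p₁ : (s : ℕ) → PolyMapF2 s} {k : ℕ → ℕ}

/-- The planted law of side `b`: `n ↦` law of `samp b` on `1ⁿ`. [cite: BogdanovTrevisan2006, Def. 2.1] -/
noncomputable def law (kit : OrbitKit p₀ p₁ k) (b : Bool) : Ensemble := fun n =>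
  (kit.samp b).outputPMF unaryEncodeNat n

/-- The hard ensemble of the line: the fair mixture of the two planted laws. [cite: BogdanovTrevisan2006, Def. 2.1] -/
noncomputable def mix (kit : OrbitKit p₀ p₁ k) : Ensemble :=
  mixEnsemble (kit.law false) (kit.law true)

end OrbitKit

/-! ### Glue (§3 of the skeleton) -/

section Glue

variable {p₀ p₁ : (s : ℕ) → PolyMapF2 s} {k : ℕ → ℕ}

/-- `affOut 1 0` is the identity on words of the right length. [folklore] -/
theorem affOut_one_zero {m : ℕ} (l : List (ZMod 2)) (hl : l.length = m) :
    affOut (1 : Matrix (Fin m) (Fin m) (ZMod 2)) 0 l = l := by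
  subst hl
  unfold affOut
  rw [Matrix.one_mulVec, add_zero]
  refine List.ext_getElem (by simp) fun i hi hi' => ?_
  rw [List.getElem_ofFn]
  exact (List.getD_eq_getElem _ _ hi').trans rfl

/-- **Every map lies in its own orbit** (`A = 1`, `b = 0`, `B = 1`, `c = 0`): affine equivalence is
reflexive, so the orbit sets are inhabited by their base points. [folklore] -/
theorem affEquiv_refl {s : ℕ} (P : PolyMapF2 s) : AffEquiv P P := by
  refine ⟨1, 0, 1, 0, isUnit_one, isUnit_one, fun x => ?_⟩
  rw [Matrix.one_mulVec, add_zero, affOut_one_zero _ (PolyMapF2.length_eval P x)]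

/-- Affinely equivalent maps have the same output entropy (tree: `PolyMapF2.entropy_eq_of_semiconj`,
`exists_equiv_affineInput`, `affineOutput_injective`). [cite: DvirGutfreundRothblumVadhan2010, §3 p.6] -/
theorem AffEquiv.entropy_eq {s : ℕ} {P Q : PolyMapF2 s} (h : AffEquiv P Q) :
    Q.entropy = P.entropy := by
  obtain ⟨A, b, B, c, hA, hB, hQ⟩ := h
  obtain ⟨e, he⟩ := exists_equiv_affineInput A hA b
  refine Summit.PneNP.PneNP.Theorems.PolyMapF2.entropy_eq_of_semiconj P Q e (affOut B c)
    (fun a a' haa' => ?_) (fun x => by rw [hQ x, he x])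
  have h1 : B.mulVec (fun i : Fin P.length => (P.eval a).getD i 0) + c =
      B.mulVec (fun i : Fin P.length => (P.eval a').getD i 0) + c :=
    List.ofFn_injective haa'
  have h2 : (fun i : Fin P.length => (P.eval a).getD i 0) =
      (fun i : Fin P.length => (P.eval a').getD i 0) :=
    affineOutput_injective B hB c h1
  refine List.ext_getElem (by simp) fun i hi hi' => ?_
  have hiP : i < P.length := by simpa using hi
  have h3 := congr_fun h2 ⟨i, hiP⟩
  simp only at h3
  rwa [List.getD_eq_getElem _ _ hi, List.getD_eq_getElem _ _ hi'] at h3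

/-- YES orbit instances of a separated pair are YES instances of `PEA 3`. [cite: DvirGutfreundRothblumVadhan2010, §3 p.6] -/
theorem orbitSet_yes_subset (hsep : Separated p₀ p₁ k) :
    OrbitSet p₁ k ⊆ {I : PEAInst | PolyMapF2.DegLE 3 I.2.1 ∧ (I.2.2 : ℝ) + 1 ≤ PolyMapF2.entropy I.2.1} := by
  rintro ⟨s, q, j⟩ ⟨hs, hj, hdeg, haff⟩
  refine ⟨hdeg, ?_⟩
  dsimp only at hs hj hdeg haff ⊢
  rw [hj, haff.entropy_eq]
  exact (hsep s hs).2

/-- NO orbit instances of a separated pair are NO instances of `PEA 3`. [cite: DvirGutfreundRothblumVadhan2010, §3 p.6] -/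
theorem orbitSet_no_subset (hsep : Separated p₀ p₁ k) :
    OrbitSet p₀ k ⊆ {I : PEAInst | PolyMapF2.DegLE 3 I.2.1 ∧ PolyMapF2.entropy I.2.1 ≤ (I.2.2 : ℝ)} := by
  rintro ⟨s, q, j⟩ ⟨hs, hj, hdeg, haff⟩
  refine ⟨hdeg, ?_⟩
  dsimp only at hs hj hdeg haff ⊢
  rw [hj, haff.entropy_eq]
  exact (hsep s hs).1

/-- `OrbitPair.yes ⊆ (PEA 3).yes` for a separated pair. [cite: DvirGutfreundRothblumVadhan2010, §3 p.6] -/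
theorem orbitPair_yes_le (hsep : Separated p₀ p₁ k) : (OrbitPair p₀ p₁ k).yes ≤ (PEA 3).yes :=
  PEAInst.encoding.toLanguage_mono (orbitSet_yes_subset hsep)

/-- `OrbitPair.no ⊆ (PEA 3).no` for a separated pair. [cite: DvirGutfreundRothblumVadhan2010, §3 p.6] -/
theorem orbitPair_no_le (hsep : Separated p₀ p₁ k) : (OrbitPair p₀ p₁ k).no ≤ (PEA 3).no :=
  PEAInst.encoding.toLanguage_mono (orbitSet_no_subset hsep)

/-- **`OrbitPair ≤ₚ PEA 3` by the identity map** (entropy is an orbit invariant). [cite: Goldreich2006, Def. 1.4] -/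
theorem orbitPair_polyTimeReducible_PEA (hsep : Separated p₀ p₁ k) :
    (OrbitPair p₀ p₁ k).PolyTimeReducible (PEA 3) :=
  ⟨id, PolyTimeComputable.id _, fun _ hw => orbitPair_yes_le hsep hw,
    fun _ hw => orbitPair_no_le hsep hw⟩

/-- A separated orbit pair is a disjoint promise problem. [cite: Goldreich2006, Def. 1.1] -/
theorem orbitPair_disjoint (hsep : Separated p₀ p₁ k) : (OrbitPair p₀ p₁ k).Disjoint :=
  Disjoint.mono (orbitPair_yes_le hsep) (orbitPair_no_le hsep) (PEA_disjoint 3)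

/-- A size slice of the `p₁`-orbit instances lies in YES. [folklore] -/
theorem side_one_subset_yes (s : ℕ) : Side p₁ k s ⊆ (OrbitPair p₀ p₁ k).yes :=
  PEAInst.encoding.toLanguage_mono fun _ hI => hI.1

/-- A size slice of the `p₀`-orbit instances lies in NO. [folklore] -/
theorem side_zero_subset_no (s : ℕ) : Side p₀ k s ⊆ (OrbitPair p₀ p₁ k).no :=
  PEAInst.encoding.toLanguage_mono fun _ hI => hI.1

/-- The base instance `⟨s, (pˢ, k s)⟩`, `s ≥ 1`, of a cubic family lies in its own size slice
(`affEquiv_refl`): the slices the planted samplers live on are inhabited. [folklore] -/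
theorem encode_base_mem_side (p : (s : ℕ) → PolyMapF2 s) (k : ℕ → ℕ) {s : ℕ} (hs : 1 ≤ s)
    (hdeg : (p s).DegLE 3) : PEAInst.encoding.encode ⟨s, (p s, k s)⟩ ∈ Side p k s :=
  ⟨⟨s, (p s, k s)⟩, ⟨⟨hs, rfl, hdeg, affEquiv_refl _⟩, rfl⟩, rfl⟩

namespace OrbitKit

/-- The planted laws are polynomial-time samplable (by their very samplers). [cite: BogdanovTrevisan2006, Def. 2.1] -/
theorem isPolySamplable_law (kit : OrbitKit p₀ p₁ k) (b : Bool) : (kit.law b).IsPolySamplable :=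
  ⟨kit.samp b, kit.samp_polyTime b, fun _ => rfl⟩

/-- The mixture is polynomial-time samplable (tree: `Ensemble.isPolySamplable_mixEnsemble`).
[cite: BogdanovTrevisan2006, Def. 2.1] -/
theorem isPolySamplable_mix (kit : OrbitKit p₀ p₁ k) : kit.mix.IsPolySamplable :=
  Ensemble.isPolySamplable_mixEnsemble (kit.isPolySamplable_law false) (kit.isPolySamplable_law true)

/-- The planted law of side `false` lives on NO instances. [folklore] -/
theorem law_false_support (kit : OrbitKit p₀ p₁ k) (n : ℕ) (w : List Bool)
    (hw : w ∈ (kit.law false n).support) : w ∈ (OrbitPair p₀ p₁ k).no :=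
  side_zero_subset_no (n + 1) (kit.samp_support false n w hw)

/-- The planted law of side `true` lives on YES instances. [folklore] -/
theorem law_true_support (kit : OrbitKit p₀ p₁ k) (n : ℕ) (w : List Bool)
    (hw : w ∈ (kit.law true n).support) : w ∈ (OrbitPair p₀ p₁ k).yes :=
  side_one_subset_yes (n + 1) (kit.samp_support true n w hw)

/-- The mixture is supported on the promise of `OrbitPair`. [cite: BogdanovTrevisan2006, Def. 2.1] -/
theorem mix_support (kit : OrbitKit p₀ p₁ k) (n : ℕ) (w : List Bool) (hw : w ∈ (kit.mix n).support) :
    w ∈ (OrbitPair p₀ p₁ k).yes ∨ w ∈ (OrbitPair p₀ p₁ k).no := by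
  rcases (mem_support_mixEnsemble_iff _ _ n w).1 hw with h | h
  · exact Or.inr (kit.law_false_support n w h)
  · exact Or.inl (kit.law_true_support n w h)

end OrbitKit

end Glue

end Summit.PneNP.PneNP.Cruxes.PeaWorstToAvg.OrbitPairRsr

-- ===== END INLINED DEFS =====


/-!
# Line `orbit-pair-rsr`, stub `stub_transfer`: CALIBRATION

`stub_transfer` (the closing, research-level stub of the line) asserts a randomized Karp reduction
`PEA 3 ≤_r OrbitPair p₀ p₁ k` into SOME `P`-uniform, cubic, `≥ s`-output, entropy-separated pair.  This file
shows it cannot be refuted short of the route's thesis X: it is IMPLIED by `PEA 3 ∈ PromiseBPP'` (the kill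
switch of the route), because (i) separated `P`-uniform cubic pairs exist unconditionally (the zero map with
`s` outputs vs the coordinate map, threshold `s - 1`: `exists_trivialPair`), and (ii) a promise-BPP decider for
`PEA 3` followed by a constant select of the two base instances of size `1` is a randomized Karp reduction
into ANY pair with inhabited sides (`promiseRandReducible_of_mem_PromiseBPP'`).  Hence
`¬ stub_transfer → PEA 3 ∉ PromiseBPP'` (`transferStmt_of_mem_PromiseBPP'`), i.e. a refutation of the stub
would prove `PeaThreeNotInP`; the stub's content is exactly "some such pair is as hard as `PEA 3`".
-/

namespace Summit.PneNP.PneNP.Cruxes.PeaWorstToAvg.OrbitPairRsr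

set_option linter.dupNamespace false -- `Summit.PneNP.PneNP.…`: summit = sub-problem name (D-0017)

open Literature.Computability.Complexity Literature.Computability.MetaComplexity
open _root_.Computability CodeFP
open Summit.PneNP.PneNP.Theorems

/-- The statement of the registered stub `stub_transfer` of line `orbit-pair-rsr`, as a proposition. [folklore] -/
def TransferStmt : Prop :=
  ∃ (p₀ p₁ : (s : ℕ) → PolyMapF2 s) (k : ℕ → ℕ),
    IsPUniform p₀ k ∧ IsPUniform p₁ k ∧ (∀ s, (p₀ s).DegLE 3) ∧ (∀ s, (p₁ s).DegLE 3) ∧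
    (∀ s, s ≤ (p₀ s).length ∧ s ≤ (p₁ s).length) ∧ Separated p₀ p₁ k ∧
    PromiseRandReducible (PEA 3) (OrbitPair p₀ p₁ k)

/-! ### The trivial separated pair: zero map vs coordinate map -/

/-- The zero map with `s` outputs on `s` variables (every output polynomial is the empty sum). [folklore] -/
def zeroFam (s : ℕ) : PolyMapF2 s := List.replicate s []

/-- The coordinate map `x ↦ (x₀, …, x_{s-1})` on `s` variables. [folklore] -/
def coordFam (s : ℕ) : PolyMapF2 s := (List.finRange s).map fun i => [[i]]

/-- The threshold sequence `k s = s - 1`. [folklore] -/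
def predThr (s : ℕ) : ℕ := s - 1

/-- The zero map evaluates to the zero word. [folklore] -/
theorem eval_zeroFam (s : ℕ) (x : Fin s → ZMod 2) : (zeroFam s).eval x = List.replicate s 0 := by
  simp [zeroFam, PolyMapF2.eval, List.map_replicate]

/-- The coordinate map evaluates to the list of coordinates. [folklore] -/
theorem eval_coordFam (s : ℕ) (x : Fin s → ZMod 2) : (coordFam s).eval x = (List.finRange s).map x := by
  simp [coordFam, PolyMapF2.eval]

/-- The zero map has output entropy `0`. [cite: DvirGutfreundRothblumVadhan2010, Claim 2.2] -/
theorem entropy_zeroFam (s : ℕ) : (zeroFam s).entropy = 0 := by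
  unfold PolyMapF2.entropy
  have : (zeroFam s).eval = fun _ => List.replicate s (0 : ZMod 2) := funext (eval_zeroFam s)
  rw [this, mapEntropy_const]

/-- The coordinate map is injective, hence has output entropy `s`. [cite: DvirGutfreundRothblumVadhan2010, Claim 2.2] -/
theorem entropy_coordFam (s : ℕ) : (coordFam s).entropy = s := by
  unfold PolyMapF2.entropy
  have hinj : Function.Injective (coordFam s).eval := by
    intro x y hxy
    rw [eval_coordFam, eval_coordFam] at hxy
    funext i
    have := List.map_inj_left.1 hxy i (List.mem_finRange i)
    exact this
  rw [mapEntropy_of_injective _ hinj, Finset.card_univ, Fintype.card_fun, ZMod.card, Fintype.card_fin,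
    Nat.cast_pow, Nat.cast_ofNat, Real.logb_pow, Real.logb_self_eq_one (by norm_num)]
  simp

/-- Both families are cubic (degrees `0` and `1`). [folklore] -/
theorem degLE_zeroFam (s : ℕ) : (zeroFam s).DegLE 3 := by
  intro p hp μ hμ
  unfold zeroFam at hp
  rw [List.eq_of_mem_replicate hp] at hμ
  exact absurd hμ List.not_mem_nil

/-- Both families are cubic (degrees `0` and `1`). [folklore] -/
theorem degLE_coordFam (s : ℕ) : (coordFam s).DegLE 3 := by
  intro p hp μ hμ
  simp only [coordFam, List.mem_map, List.mem_finRange, true_and] at hp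
  obtain ⟨i, rfl⟩ := hp
  simp only [List.mem_singleton] at hμ
  subst hμ
  simp

/-- Both families have exactly `s` outputs. [folklore] -/
theorem length_fams (s : ℕ) : s ≤ (zeroFam s).length ∧ s ≤ (coordFam s).length := by
  simp [zeroFam, coordFam]

/-- The pair is entropy-separated across `k s = s - 1` from size `1` on. [folklore] -/
theorem separated_fams : Separated zeroFam coordFam predThr := by
  intro s hs
  refine ⟨by rw [entropy_zeroFam]; positivity, ?_⟩
  rw [entropy_coordFam, predThr, Nat.cast_sub hs, Nat.cast_one]
  linarith

/-! ### `P`-uniformity of the two families (CodeFP programs on the unary size) -/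

/-- The untyped presentation of `⟨s, (zeroFam s, s - 1)⟩` is computed on codes from `1ˢ`. [folklore] -/
theorem codeFP_zeroFam :
    CodeFP unE PEAInst.untypedCode fun s => PEAInst.untyped ⟨s, (zeroFam s, predThr s)⟩ := by
  have hrep : CodeFP unE (rawE (listE (listE natE))) fun s => List.replicate s ([] : List (List ℕ)) :=
    (replicateOf (listE (listE natE))).comp ((const unE ([] : List (List ℕ))).pair (CodeFP.id unE))
  have hP : CodeFP unE (listE (listE (listE natE))) fun s => List.replicate s ([] : List (List ℕ)) :=
    (listOfRaw _).comp hrep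
  have hk : CodeFP unE natE fun s => s - 1 := natSub.comp (natOfUn.pair (const unE 1))
  have h : CodeFP unE (pairE natE (pairE (listE (listE (listE natE))) natE))
      fun s => (s, (List.replicate s ([] : List (List ℕ)), s - 1)) :=
    natOfUn.pair (hP.pair hk)
  refine h.congr fun s => ?_
  simp [PEAInst.untyped, zeroFam, predThr, List.map_replicate]

/-- The untyped presentation of `⟨s, (coordFam s, s - 1)⟩` is computed on codes from `1ˢ`. [folklore] -/
theorem codeFP_coordFam :
    CodeFP unE PEAInst.untypedCode fun s => PEAInst.untyped ⟨s, (coordFam s, predThr s)⟩ := by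
  have hitem : CodeFP natE (listE (listE natE)) fun i : ℕ => [[i]] :=
    (listOfRaw (listE natE)).comp ((rawSingleton (listE natE)).comp
      ((listOfRaw natE).comp (rawSingleton natE)))
  have hrange : CodeFP unE (rawE natE) fun s => List.range s :=
    (rangeOf.comp ((CodeFP.id unE).pair natOfUn)).congr fun s => by simp
  have hP : CodeFP unE (listE (listE (listE natE))) fun s => (List.range s).map fun i : ℕ => [[i]] :=
    (listOfRaw _).comp ((map₀ hitem).comp hrange)
  have hk : CodeFP unE natE fun s => s - 1 := natSub.comp (natOfUn.pair (const unE 1))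
  have h : CodeFP unE (pairE natE (pairE (listE (listE (listE natE))) natE))
      fun s => (s, ((List.range s).map fun i : ℕ => [[i]], s - 1)) :=
    natOfUn.pair (hP.pair hk)
  refine h.congr fun s => ?_
  have hmap : ((coordFam s).map (List.map (List.map Fin.val))) = (List.range s).map fun i : ℕ => [[i]] := by
    rw [coordFam, List.map_map, ← List.map_coe_finRange_eq_range, List.map_map]
    rfl
  simp only [PEAInst.untyped, predThr, hmap]

/-- `P`-uniformity from a CodeFP program for the untyped presentation. [folklore] -/
theorem isPUniform_of_codeFP {p : (s : ℕ) → PolyMapF2 s} {k : ℕ → ℕ}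
    (h : CodeFP unE PEAInst.untypedCode fun s => PEAInst.untyped ⟨s, (p s, k s)⟩) : IsPUniform p k := by
  obtain ⟨f, hf, hspec⟩ := h
  exact ⟨f, hf, fun s => by rw [PEAInst.encode_eq_untypedCode]; exact hspec s⟩

/-- The zero family is `P`-uniform. [folklore] -/
theorem isPUniform_zeroFam : IsPUniform zeroFam predThr := isPUniform_of_codeFP codeFP_zeroFam

/-- The coordinate family is `P`-uniform. [folklore] -/
theorem isPUniform_coordFam : IsPUniform coordFam predThr := isPUniform_of_codeFP codeFP_coordFam

/-- **Separated `P`-uniform cubic pairs exist** (the side conditions of `stub_transfer` other than the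
reduction are jointly satisfiable). [folklore] -/
theorem exists_trivialPair :
    IsPUniform zeroFam predThr ∧ IsPUniform coordFam predThr ∧ (∀ s, (zeroFam s).DegLE 3) ∧
      (∀ s, (coordFam s).DegLE 3) ∧ (∀ s, s ≤ (zeroFam s).length ∧ s ≤ (coordFam s).length) ∧
      Separated zeroFam coordFam predThr :=
  ⟨isPUniform_zeroFam, isPUniform_coordFam, degLE_zeroFam, degLE_coordFam, length_fams, separated_fams⟩

/-! ### A promise-BPP decider is a randomized Karp reduction into any pair with inhabited sides -/

/-- A `PMF` gives every set outer measure `≠ ⊤` (it is `≤ 1`). [folklore] -/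
theorem pmf_toOuterMeasure_ne_top {α : Type} (p : PMF α) (s : Set α) : p.toOuterMeasure s ≠ ⊤ := by
  have h : p.toOuterMeasure s ≤ p.toOuterMeasure Set.univ :=
    PMF.toOuterMeasure_mono _ fun _ _ => Set.mem_univ _
  rw [(PMF.toOuterMeasure_apply_eq_one_iff _ _).2 (Set.subset_univ _)] at h
  exact ne_top_of_le_ne_top ENNReal.one_ne_top h

/-- **Deciding then selecting a base point is a randomized Karp reduction.** If `Q₁ ∈ PromiseBPP'` is
disjoint and `Q₂` has a YES instance `yW` and a NO instance `nW`, then `PromiseRandReducible Q₁ Q₂`: run an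
error-`≤ 1/3` decider for `Q₁` (`exists_randAlg_promise_error_le`) and output `yW` or `nW` accordingly.
[cite: AroraBarak2009, §7.6 (randomized reductions)] -/
theorem promiseRandReducible_of_mem_PromiseBPP' {Q₁ Q₂ : PromiseProblem} (hQ₁ : Q₁.Disjoint)
    (h : Q₁ ∈ PromiseBPP') {yW nW : List Bool} (hy : yW ∈ Q₂.yes) (hn : nW ∈ Q₂.no) :
    PromiseRandReducible Q₁ Q₂ := by
  obtain ⟨A, hA, ⟨q, hq⟩, -, herr⟩ :=
    exists_randAlg_promise_error_le hQ₁ h (by norm_num : (0 : ℝ) < 1 / 3)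
  -- the selector `b ↦ if b then yW else nW` on codes
  have hsel : CodeFP bitE (id : List Bool → List Bool) fun b : Bool => if b then yW else nW :=
    (CodeFP.id bitE).ite (const bitE yW) (const bitE nW)
  let R : RandAlg (List Bool) (List Bool) :=
    { run := fun x r => if A.run x r then yW else nW, coinLen := A.coinLen }
  have hRpoly : R.IsPolyTime id (id : List Bool → List Bool) := by
    refine ⟨?_, hA.2⟩
    have h1 : PolyTimeComputable (fun p : List Bool × List Bool => boolPair (id p.1) p.2) encodeBool
        (Function.uncurry A.run) := hA.1
    have h2 : PolyTimeComputable encodeBool (id : List Bool → List Bool)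
        (fun b : Bool => if b then yW else nW) :=
      PolyTimeComputable.of_encode_eq (id : Bool → Bool) (fun b => rfl) (fun _ => rfl) hsel.polyTimeComputable
    have h := PolyTimeComputable.comp_holds h2 h1
    exact PolyTimeComputable.of_encode_eq (id : List Bool × List Bool → List Bool × List Bool)
      (fun _ => rfl) (fun p => by rfl) h
  have hmap : ∀ x, R.outputPMF id x = (A.outputPMF id x).map fun b => if b then yW else nW := fun x => by
    simp only [RandAlg.outputPMF, PMF.map_comp]
    rfl
  have hpr : ∀ x (E : Set (List Bool)), R.pr id x E =
      A.pr id x ((fun b : Bool => if b then yW else nW) ⁻¹' E) := fun x E => by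
    simp only [RandAlg.pr, hmap, PMF.toOuterMeasure_map_apply]
  refine ⟨R, hRpoly, ⟨q, hq⟩, fun x hx => ?_, fun x hx => ?_⟩
  · -- YES: `Pr[R x ∈ Q₂.yes] ≥ Pr[A x = true] = 1 - Pr[A x ≠ true] ≥ 2/3`
    have hind : Q₁.yes.boolIndicator x = true := (Set.mem_iff_boolIndicator _ _).1 hx
    have he := herr x (Or.inl hx)
    rw [hind, RandAlg.pr_ne_eq_one_sub] at he
    have hmono : A.pr id x {true} ≤ A.pr id x ((fun b : Bool => if b then yW else nW) ⁻¹' Q₂.yes) := by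
      unfold RandAlg.pr
      refine ENNReal.toReal_mono (pmf_toOuterMeasure_ne_top _ _) (PMF.toOuterMeasure_mono _ fun b hb => ?_)
      have hb' : b = true := hb.1
      subst hb'
      show (if true then yW else nW) ∈ Q₂.yes
      rw [if_pos rfl]
      exact hy
    rw [hpr]
    linarith
  · -- NO: symmetric with `false` and `nW`
    have hnot : x ∉ Q₁.yes := fun hx' => Set.disjoint_left.1 hQ₁ hx' hx
    have hind : Q₁.yes.boolIndicator x = false := (Set.notMem_iff_boolIndicator _ _).1 hnot
    have he := herr x (Or.inr hx)
    rw [hind, RandAlg.pr_ne_eq_one_sub] at he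
    have hmono : A.pr id x {false} ≤ A.pr id x ((fun b : Bool => if b then yW else nW) ⁻¹' Q₂.no) := by
      unfold RandAlg.pr
      refine ENNReal.toReal_mono (pmf_toOuterMeasure_ne_top _ _) (PMF.toOuterMeasure_mono _ fun b hb => ?_)
      have hb' : b = false := hb.1
      subst hb'
      show (if false then yW else nW) ∈ Q₂.no
      rw [if_neg Bool.false_ne_true]
      exact hn
    rw [hpr]
    linarith

/-! ### Calibration of `stub_transfer` -/

/-- **`stub_transfer` is implied by the kill switch `PEA 3 ∈ PromiseBPP'`** (so it is irrefutable short of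
`PEA 3 ∉ PromiseBPP'`, which already gives the route's thesis `PeaThreeNotInP`): reduce by deciding, into the
trivial pair. [cite: AroraBarak2009, §7.6] -/
theorem transferStmt_of_mem_PromiseBPP' (h : PEA 3 ∈ PromiseBPP') : TransferStmt := by
  refine ⟨zeroFam, coordFam, predThr, isPUniform_zeroFam, isPUniform_coordFam, degLE_zeroFam,
    degLE_coordFam, length_fams, separated_fams, ?_⟩
  have hy : PEAInst.encoding.encode ⟨1, (coordFam 1, predThr 1)⟩ ∈ (OrbitPair zeroFam coordFam predThr).yes :=
    side_one_subset_yes (p₀ := zeroFam) 1 (encode_base_mem_side coordFam predThr le_rfl (degLE_coordFam 1))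
  have hn : PEAInst.encoding.encode ⟨1, (zeroFam 1, predThr 1)⟩ ∈ (OrbitPair zeroFam coordFam predThr).no :=
    side_zero_subset_no (p₁ := coordFam) 1 (encode_base_mem_side zeroFam predThr le_rfl (degLE_zeroFam 1))
  exact promiseRandReducible_of_mem_PromiseBPP' (PEA_disjoint 3) h hy hn

/-- Contrapositive: a refutation of `stub_transfer` proves worst-case hardness of `PEA 3`. [folklore] -/
theorem not_mem_PromiseBPP'_of_not_transferStmt (h : ¬ TransferStmt) : PEA 3 ∉ PromiseBPP' :=
  fun hB => h (transferStmt_of_mem_PromiseBPP' hB)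

end Summit.PneNP.PneNP.Cruxes.PeaWorstToAvg.OrbitPairRsr
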